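/-
Copyright (c) 2026 the pub-hodgecm-mathlib formalisation cell (harness21).  Prover seat hodgecm-mathlib-K2Liu-p11 (g2), Track B «K2-LIT»,
#184♮ = hLiu418 = `stmt-HodgeConjecture-24832`; LEAD F0P6-plan (g13) 10:13:40Z «the 20-line corollary `n_{τ′}(½) = 0` by the second
lander» ∕ LEAD F0P6-plan (g14) BATCH #1 (γ) «(CR-loc) corollary» ∕ K2Liu-p11 (g2) (C2).  THEOREMS ONLY (no `def`, no `instance`, no notation,
no named-fact hypothesis, no `sorry`).
-/
import Summits.HodgeConjecture.HodgeConjecture.Theorems.K2LiuArchIntertwiningLieDerivativeExp  -- ★ K2E5-p16 (g6) (A): swap + closed form (`exp` form)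
import Summits.HodgeConjecture.HodgeConjecture.Theorems.K2LiuArchScalarSectionPDerivative      -- ★ (this seat) (B) FILE 2: `pMinus_algebra`, letters
import Summits.HodgeConjecture.HodgeConjecture.Theorems.K2LiuArchPMinusCarrier                  -- ★ (this seat) (C1): the carriers are flat
import Summits.HodgeConjecture.HodgeConjecture.Theorems.K2LiuArchNormalisedScalarCont          -- ★ (this lineage): `n_k`, `M*`
import Summits.HodgeConjecture.HodgeConjecture.Theorems.K2LiuHermitianTubeCRDeriv               -- ★ (this lineage): `μ b ∈ 𝔲(J)`
import Summits.HodgeConjecture.HodgeConjecture.Theorems.K2LiuHermitianTubeCRCartan              -- ★ (this lineage): `σ b ∈ 𝔲(J)`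
import Mathlib.Analysis.Complex.CauchyIntegral
import Mathlib.Analysis.Analytic.Uniqueness
import HarnessLib

/-!
# Crux `HLiu418`, A∞ organ: the (CR-loc) recursion and the `𝔭⁻`-KERNEL OF `M*_w(½)` — `n_{τ′}(½) = 0`

Cell `hodgecm-mathlib`, crux item hLiu418 = `stmt-HodgeConjecture-24832` (helper lane `--supports`, count-neutral).

For hermitian `b` the letters `μ b = (b 0; 0 −b)`, `σ b = (0 b; b 0)` lie in `𝔲(J)` (★ H1-E), and `𝔭⁻(b)• = D_{μb} − i·D_{σb}`.  ★ (A)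
(K2E5-p16 (g6)) gives `M_w(D_W f⁰_{s,k}) = c_k(s)·D_W f⁰_{−s,k}` on `U(2,2)` for `W ∈ 𝔲(J)`, `re s > ½`; ★ (B) (this seat) gives
`D_{μb} f⁰_{s,k} − i·D_{σb} f⁰_{s,k} = λ⁻_k(s)·φ⁻_{b,s}`, `λ⁻_k(s) = 2s + 2 − k`, `φ⁻_{b,s} = f⁰_{s,k}·conj T_b`.  Hence (§2)
**`λ⁻_k(s) · M_w φ⁻_{b,s} = c_k(s) · λ⁻_k(−s) · φ⁻_{b,−s}`** on `U(2,2)` — the (CR-loc) RECURSION, with NO multiplicity-one input — and for the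
Gaussian line type `k = 1` (§3) **`M*_w(s) φ⁻_{b,s} = ((1 − 2s)∕(1 + 2s)) · φ⁻_{b,−s}`** on `re s > ½`: the normalised operator's scalar on
the `K_w`-type `τ′ = k₀ ⊗ 𝔭⁻` is `n_{τ′}(s) = (1−2s)∕(1+2s)`, which VANISHES at `s = ½`.  §4 transports this to every holomorphic continuation
(★ p859316's identity-theorem pattern, ★ (C1) `eq_pMinusCarrier_of_flat` for «every flat family through `φ⁻_{b,½}`»):
**`pMinus_half_eq_zero`** — the arch clause of U1-glob(σ) (LEAD (F-a) 09:54:40Z) at the NON-scalar type `τ′`, i.e. the (CR) face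
`Y·T₁x = 0`, `Y ∈ 𝔭⁻_σ`, of F-T1-hol.  The mirror `k = −1` ∕ `𝔭⁺` statements are the `conj`-free twins (§2–§4, `λ⁺_{−1}(s) = 2s + 1`).
References: [Shimura1997, §16.4]; [Knapp1986, Ch. VII §2]; [KudlaRallis1994 (citation only)].
HONEST LABEL: HC_CM is proved only modulo the 7 printed citations (2 remaining named inputs: hLiu418 = stmt-HodgeConjecture-24832,
h413 = stmt-HodgeConjecture-24833) until rung 0 closes; count-neutral helper, closes no socket.
-/

set_option autoImplicit false
set_option linter.dupNamespace false

noncomputable section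

open Complex Matrix Filter MeasureTheory Set
open scoped ComplexConjugate ComplexOrder Topology

namespace Summit.HodgeConjecture.HodgeConjecture.Cruxes.HLiu418.K2LiuArchPMinusIntertwiningKernel

open Literature.NumberTheory.ModularForms.SiegelUpperHalfSpace (denom moeb)
open Summit.HodgeConjecture.HodgeConjecture.Cruxes.HLiu418.K2LiuHermitianTubeCocycle
open Summit.HodgeConjecture.HodgeConjecture.Cruxes.HLiu418.K2LiuArchInducedTubeDefs
open Summit.HodgeConjecture.HodgeConjecture.Cruxes.HLiu418.K2LiuArchNormalisingScalar
open Summit.HodgeConjecture.HodgeConjecture.Cruxes.HLiu418.K2LiuArchNormalisedScalarCont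
open Summit.HodgeConjecture.HodgeConjecture.Cruxes.HLiu418.K2LiuArchIntertwiningRightEquivariance
open Summit.HodgeConjecture.HodgeConjecture.Cruxes.HLiu418.K2LiuArchScalarSectionCurveDerivative
open Summit.HodgeConjecture.HodgeConjecture.Cruxes.HLiu418.K2LiuArchScalarSectionPDerivative
open Summit.HodgeConjecture.HodgeConjecture.Cruxes.HLiu418.K2LiuArchPMinusCarrier
open Summit.HodgeConjecture.HodgeConjecture.Cruxes.HLiu418.K2LiuArchIntertwiningContinuedHalf
open Summit.HodgeConjecture.HodgeConjecture.Cruxes.HLiu418.K2LiuArchIntertwiningLieDerivative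
open Summit.HodgeConjecture.HodgeConjecture.Cruxes.HLiu418.K2LiuArchIntertwiningLieDerivativeExp
open Summit.HodgeConjecture.HodgeConjecture.Cruxes.HLiu418.K2LiuLieRayDifferentiability
open Summit.HodgeConjecture.HodgeConjecture.Cruxes.HLiu418.K2LiuHermitianTubeCRDeriv

/-! ## §1  The intertwining integral only sees `U(J)`, and splits over integrable differences -/

/-- `M_w` only sees the values on `U(J)`: if `f = f'` on `U(J)` then `M_w f (h) = M_w f' (h)` for `h ∈ U(J)`. [folklore] -/
theorem archIntertwining_congr_UJ {l : Type*} [Fintype l] [DecidableEq l] {f f' : Matrix (l ⊕ l) (l ⊕ l) ℂ → ℂ}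
    (hf : ∀ g : Matrix (l ⊕ l) (l ⊕ l) ℂ, gᴴ * Matrix.J l ℂ * g = Matrix.J l ℂ → f g = f' g)
    {h : Matrix (l ⊕ l) (l ⊕ l) ℂ} (hh : hᴴ * Matrix.J l ℂ * h = Matrix.J l ℂ) :
    archIntertwining f h = archIntertwining f' h := by
  rw [archIntertwining_apply, archIntertwining_apply]
  refine integral_congr_ae (Filter.Eventually.of_forall fun r => ?_)
  exact hf _ (mul_mem_UJ (J_mul_transl_hermOfReal_mem r) hh)

/-! ## §2  The (CR-loc) recursion `λ⁻_k(s) · M_w φ⁻_{b,s} = c_k(s) · λ⁻_k(−s) · φ⁻_{b,−s}` -/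

/-- The Lie-derivative integrand of ★ (A) along `exp (tW)` is integrable on the big cell at `t = 0` (`g ∈ U(2,2)`, `re s > ½`; the
first component of the dominated-differentiation theorem, ★ `integrable_lieDeriv_archScalarSection` on the `exp` curve). [Shimura1997, §16.4] -/
theorem integrable_lieDeriv_exp (k : ℤ) {s : ℂ} (hs : 1 / 2 < s.re) {g : Matrix (Fin 2 ⊕ Fin 2) (Fin 2 ⊕ Fin 2) ℂ}
    (hg : gᴴ * Matrix.J (Fin 2) ℂ * g = Matrix.J (Fin 2) ℂ) (W : Matrix (Fin 2 ⊕ Fin 2) (Fin 2 ⊕ Fin 2) ℂ) :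
    Integrable fun r : Fin 2 → Fin 2 → ℝ =>
      archScalarSection k s (Matrix.J (Fin 2) ℂ * fromBlocks 1 (hermOfReal r) 0 1 * g) *
        ((((k : ℂ) - 2 * s - 2) / 2 - k) *
            ((denom (Matrix.J (Fin 2) ℂ * fromBlocks 1 (hermOfReal r) 0 1 * g) (I • (1 : Matrix (Fin 2) (Fin 2) ℂ)))⁻¹ *
              denom (Matrix.J (Fin 2) ℂ * fromBlocks 1 (hermOfReal r) 0 1 * g * W) (I • (1 : Matrix (Fin 2) (Fin 2) ℂ))).trace +
          ((k : ℂ) - 2 * s - 2) / 2 *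
            conj ((denom (Matrix.J (Fin 2) ℂ * fromBlocks 1 (hermOfReal r) 0 1 * g) (I • (1 : Matrix (Fin 2) (Fin 2) ℂ)))⁻¹ *
              denom (Matrix.J (Fin 2) ℂ * fromBlocks 1 (hermOfReal r) 0 1 * g * W) (I • (1 : Matrix (Fin 2) (Fin 2) ℂ))).trace) := by
  have h := integrable_lieDeriv_archScalarSection k hs hg (γ := fun t : ℝ => NormedSpace.exp (t • W))
    (γ' := fun t : ℝ => W * NormedSpace.exp (t • W)) (exp_zero_smul_eq_one W) (hasDerivAt_exp_smul_entry_at W)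
    (fun i j => (continuous_mul_exp_smul_entry W i j).continuousAt)
  simpa only [exp_zero_smul_eq_one, Matrix.mul_one] using h

/-- **THE (CR-loc) RECURSION** for hermitian `b`, `g ∈ U(2,2)`, `re s > ½`:
`(2s + 2 − k) · M_w φ⁻_{b,s} (g) = c_k(s) · (2 − 2s − k) · φ⁻_{b,−s}(g)`, `φ⁻_{b,s} = f⁰_{s,k} · conj T_b` — from ★ (A) at `W = μ b, σ b` and
★ (B) `pMinus_algebra` ∕ `trace_letters_mu_sigma`; NO multiplicity-one input. [Shimura1997, §16.4; Knapp1986, Ch. VII §2] -/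
theorem lambdaMinus_mul_archIntertwining_pMinusCarrier (k : ℤ) {s : ℂ} (hs : 1 / 2 < s.re)
    {g : Matrix (Fin 2 ⊕ Fin 2) (Fin 2 ⊕ Fin 2) ℂ} (hg : gᴴ * Matrix.J (Fin 2) ℂ * g = Matrix.J (Fin 2) ℂ)
    {b : Matrix (Fin 2) (Fin 2) ℂ} (hb : bᴴ = b) :
    (2 * s + 2 - k) * archIntertwining (fun y => archScalarSection k s y *
        conj (((denom y (I • (1 : Matrix (Fin 2) (Fin 2) ℂ)))⁻¹ * denom y (-(I • (1 : Matrix (Fin 2) (Fin 2) ℂ))) * b).trace)) g =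
      archScalarCoeff k s * ((2 * (-s) + 2 - k) * (archScalarSection k (-s) g *
        conj (((denom g (I • (1 : Matrix (Fin 2) (Fin 2) ℂ)))⁻¹ * denom g (-(I • (1 : Matrix (Fin 2) (Fin 2) ℂ))) * b).trace))) := by
  -- the two real letters
  have hμ := levi_gen_mem (l := Fin 2) hb
  have hσ := K2LiuHermitianTubeCRCartan.sigma_gen_mem (l := Fin 2) hb
  -- ★ (A): the closed forms for `W = μ b` and `W = σ b`
  have hAμ := archIntertwining_lieDeriv_archScalarSection_exp_eq k hs hg (conjTranspose_exp_mul_J_mul_exp hμ)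
  have hAσ := archIntertwining_lieDeriv_archScalarSection_exp_eq k hs hg (conjTranspose_exp_mul_J_mul_exp hσ)
  -- integrability of the two Lie-derivative integrands (to split `M_w` over the difference)
  have hIμ := integrable_lieDeriv_exp k hs hg (fromBlocks b 0 0 (-b))
  have hIσ := integrable_lieDeriv_exp k hs hg (fromBlocks 0 b b 0)
  -- abbreviations for the two `D_W f⁰_{s,k}` integrands as functions on `M₄(ℂ)`
  set m : ℂ := (k : ℂ) - 2 * s - 2 with hm
  set m' : ℂ := (k : ℂ) - 2 * (-s) - 2 with hm'
  set Dμ : Matrix (Fin 2 ⊕ Fin 2) (Fin 2 ⊕ Fin 2) ℂ → ℂ := fun y => archScalarSection k s y *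
      ((m / 2 - k) * ((denom y (I • (1 : Matrix (Fin 2) (Fin 2) ℂ)))⁻¹ *
          denom (y * fromBlocks b 0 0 (-b)) (I • (1 : Matrix (Fin 2) (Fin 2) ℂ))).trace +
        m / 2 * conj ((denom y (I • (1 : Matrix (Fin 2) (Fin 2) ℂ)))⁻¹ *
          denom (y * fromBlocks b 0 0 (-b)) (I • (1 : Matrix (Fin 2) (Fin 2) ℂ))).trace) with hDμ
  set Dσ : Matrix (Fin 2 ⊕ Fin 2) (Fin 2 ⊕ Fin 2) ℂ → ℂ := fun y => archScalarSection k s y *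
      ((m / 2 - k) * ((denom y (I • (1 : Matrix (Fin 2) (Fin 2) ℂ)))⁻¹ *
          denom (y * fromBlocks 0 b b 0) (I • (1 : Matrix (Fin 2) (Fin 2) ℂ))).trace +
        m / 2 * conj ((denom y (I • (1 : Matrix (Fin 2) (Fin 2) ℂ)))⁻¹ *
          denom (y * fromBlocks 0 b b 0) (I • (1 : Matrix (Fin 2) (Fin 2) ℂ))).trace) with hDσ
  -- pointwise: `Dμ y − i·Dσ y = (2s + 2 − k)·φ⁻_{b,s}(y)` (★ (B), generic `y`)
  have hcomb : ∀ (t : ℂ) (y : Matrix (Fin 2 ⊕ Fin 2) (Fin 2 ⊕ Fin 2) ℂ),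
      archScalarSection k t y * ((((k : ℂ) - 2 * t - 2) / 2 - k) *
            ((denom y (I • (1 : Matrix (Fin 2) (Fin 2) ℂ)))⁻¹ * denom (y * fromBlocks b 0 0 (-b)) (I • (1 : Matrix (Fin 2) (Fin 2) ℂ))).trace +
          ((k : ℂ) - 2 * t - 2) / 2 *
            conj ((denom y (I • (1 : Matrix (Fin 2) (Fin 2) ℂ)))⁻¹ * denom (y * fromBlocks b 0 0 (-b)) (I • (1 : Matrix (Fin 2) (Fin 2) ℂ))).trace) -
        I * (archScalarSection k t y * ((((k : ℂ) - 2 * t - 2) / 2 - k) *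
            ((denom y (I • (1 : Matrix (Fin 2) (Fin 2) ℂ)))⁻¹ * denom (y * fromBlocks 0 b b 0) (I • (1 : Matrix (Fin 2) (Fin 2) ℂ))).trace +
          ((k : ℂ) - 2 * t - 2) / 2 *
            conj ((denom y (I • (1 : Matrix (Fin 2) (Fin 2) ℂ)))⁻¹ * denom (y * fromBlocks 0 b b 0) (I • (1 : Matrix (Fin 2) (Fin 2) ℂ))).trace)) =
        (2 * t + 2 - k) * (archScalarSection k t y *
          conj (((denom y (I • (1 : Matrix (Fin 2) (Fin 2) ℂ)))⁻¹ * denom y (-(I • (1 : Matrix (Fin 2) (Fin 2) ℂ))) * b).trace)) := by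
    intro t y
    obtain ⟨h1, h2⟩ := trace_letters_mu_sigma (l := Fin 2) y b
    rw [pMinus_algebra _ _ _ _ _ _ h1 h2]
    ring
  -- left side: `M_w (Dμ − i·Dσ) = M_w ((2s+2−k) φ⁻_{b,s})`
  have hL : archIntertwining Dμ g - I * archIntertwining Dσ g =
      (2 * s + 2 - k) * archIntertwining (fun y => archScalarSection k s y *
        conj (((denom y (I • (1 : Matrix (Fin 2) (Fin 2) ℂ)))⁻¹ * denom y (-(I • (1 : Matrix (Fin 2) (Fin 2) ℂ))) * b).trace)) g := by
    rw [← archIntertwining_const_mul I Dσ g, ← archIntertwining_sub hIμ (hIσ.const_mul I |>.congr ?_), ← archIntertwining_const_mul]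
    · congr 1
      funext y
      exact hcomb s y
    · exact Filter.Eventually.of_forall fun r => rfl
  -- right side: the closed forms, combined by the same algebra at `−s`
  have hR : archIntertwining Dμ g - I * archIntertwining Dσ g =
      archScalarCoeff k s * ((2 * (-s) + 2 - k) * (archScalarSection k (-s) g *
        conj (((denom g (I • (1 : Matrix (Fin 2) (Fin 2) ℂ)))⁻¹ * denom g (-(I • (1 : Matrix (Fin 2) (Fin 2) ℂ))) * b).trace))) := by
    rw [hDμ, hDσ, hAμ, hAσ, ← hcomb (-s) g]
    ring
  rw [← hL, hR]

/-- **THE NORMALISED (CR-loc) RECURSION, BY THE CONTINUED NAME**: for hermitian `b`, `g ∈ U(2,2)`, `re s > ½`,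
`(2s + 2 − k) · M*_w(s) φ⁻_{b,s} (g) = n_k(s) · (2 − 2s − k) · φ⁻_{b,−s}(g)` (`M* = 2Q⁻¹M_w`, `n_k = archNormalisedScalarCont k`, ★ (L1)).
[Shimura1997, §16.4; KudlaRallis1994 (citation only)] -/
theorem lambdaMinus_mul_archIntertwiningNormalized_pMinusCarrier (k : ℤ) {s : ℂ} (hs : 1 / 2 < s.re)
    {g : Matrix (Fin 2 ⊕ Fin 2) (Fin 2 ⊕ Fin 2) ℂ} (hg : gᴴ * Matrix.J (Fin 2) ℂ * g = Matrix.J (Fin 2) ℂ)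
    {b : Matrix (Fin 2) (Fin 2) ℂ} (hb : bᴴ = b) :
    (2 * s + 2 - k) * archIntertwiningNormalized s (fun y => archScalarSection k s y *
        conj (((denom y (I • (1 : Matrix (Fin 2) (Fin 2) ℂ)))⁻¹ * denom y (-(I • (1 : Matrix (Fin 2) (Fin 2) ℂ))) * b).trace)) g =
      archNormalisedScalarCont k s * ((2 - 2 * s - k) * (archScalarSection k (-s) g *
        conj (((denom g (I • (1 : Matrix (Fin 2) (Fin 2) ℂ)))⁻¹ * denom g (-(I • (1 : Matrix (Fin 2) (Fin 2) ℂ))) * b).trace))) := by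
  rw [archIntertwiningNormalized_apply, archNormalisedScalarCont_eq k hs, mul_left_comm, lambdaMinus_mul_archIntertwining_pMinusCarrier k hs hg hb]
  ring

/-! ## §3  The Gaussian line type `k = 1`: `M*_w(s) φ⁻_{b,s} = ((1 − 2s)∕(1 + 2s)) · φ⁻_{b,−s}` -/

/-- On `re s > ½`, `1 + 2s ≠ 0`. [folklore] -/
theorem one_add_two_mul_ne_zero {s : ℂ} (hs : 0 < s.re) : (1 + 2 * s : ℂ) ≠ 0 := by
  intro h
  have := congrArg Complex.re h
  simp only [Complex.add_re, Complex.one_re, Complex.mul_re, Complex.re_ofNat, Complex.im_ofNat, zero_mul, sub_zero,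
    Complex.zero_re] at this
  linarith

/-- **THE LINE TYPE**: for `k = 1`, hermitian `b`, `g ∈ U(2,2)`, `re s > ½`:
`M*_w(s) φ⁻_{b,s} (g) = ((1 − 2s)∕(1 + 2s)) · φ⁻_{b,−s}(g)` — the normalised operator's scalar on `τ′ = k₀ ⊗ 𝔭⁻` is `(1−2s)∕(1+2s)`
(`n_1 ≡ 1`, ★ `archNormalisedScalarCont_of_natAbs_eq_one`). [Shimura1997, §16.4; KudlaRallis1994 (citation only)] -/
theorem archIntertwiningNormalized_pMinusCarrier_one {s : ℂ} (hs : 1 / 2 < s.re)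
    {g : Matrix (Fin 2 ⊕ Fin 2) (Fin 2 ⊕ Fin 2) ℂ} (hg : gᴴ * Matrix.J (Fin 2) ℂ * g = Matrix.J (Fin 2) ℂ)
    {b : Matrix (Fin 2) (Fin 2) ℂ} (hb : bᴴ = b) :
    archIntertwiningNormalized s (fun y => archScalarSection 1 s y *
        conj (((denom y (I • (1 : Matrix (Fin 2) (Fin 2) ℂ)))⁻¹ * denom y (-(I • (1 : Matrix (Fin 2) (Fin 2) ℂ))) * b).trace)) g =
      (1 - 2 * s) / (1 + 2 * s) * (archScalarSection 1 (-s) g *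
        conj (((denom g (I • (1 : Matrix (Fin 2) (Fin 2) ℂ)))⁻¹ * denom g (-(I • (1 : Matrix (Fin 2) (Fin 2) ℂ))) * b).trace)) := by
  have h := lambdaMinus_mul_archIntertwiningNormalized_pMinusCarrier 1 hs hg hb
  rw [archNormalisedScalarCont_of_natAbs_eq_one (by norm_num) s, one_mul, Int.cast_one] at h
  have hne : (2 * s + 2 - 1 : ℂ) ≠ 0 := by
    rw [show (2 * s + 2 - 1 : ℂ) = 1 + 2 * s by ring]
    exact one_add_two_mul_ne_zero (by linarith)
  have h' := congrArg (fun z => (2 * s + 2 - 1 : ℂ)⁻¹ * z) h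
  rw [← mul_assoc, inv_mul_cancel₀ hne, one_mul] at h'
  rw [h', show (2 - 2 * s - 1 : ℂ) = 1 - 2 * s by ring, show (2 * s + 2 - 1 : ℂ) = 1 + 2 * s by ring]
  field_simp

/-! ## §4  The face at `s = ½`: the continued `M*_w` KILLS the `𝔭⁻`-type through the Gaussian line (`n_{τ′}(½) = 0`) -/

/-- **`𝔭⁻`-KERNEL OF THE CONTINUED NORMALISED OPERATOR AT `s = ½` (line type `k = 1`).**  Let `b` be hermitian, `h ∈ U(2,2)`, and let
`F s` be, for `½ < re s`, ANY family with the weight-one Siegel-parabolic law whose restriction to `U(J) ∩ Stab(i1)` is that of the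
`𝔭⁻`-carrier `φ⁻_{b,½}` (i.e. the flat family through `𝔭⁻(b)•f⁰_{½,1} = 2·φ⁻_{b,½}`, up to the factor `2`; by ★ (C1) it IS `φ⁻_{b,s}` on
`U(J)`).  Then every `Fn` holomorphic on `{0 < re s}` with `Fn s = M*_w(s) (F s) (h)` on `½ < re s` satisfies **`Fn (½) = 0`** — the arch
clause of U1-glob(σ) at the `K_w`-type `τ′ = k₀ ⊗ 𝔭⁻` ((CR) → F-T1-hol). [Shimura1997, §16.4; KudlaRallis1994 (citation only)] -/
theorem pMinus_half_eq_zero {b : Matrix (Fin 2) (Fin 2) ℂ} (hb : bᴴ = b)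
    {h : Matrix (Fin 2 ⊕ Fin 2) (Fin 2 ⊕ Fin 2) ℂ} (hh : hᴴ * Matrix.J (Fin 2) ℂ * h = Matrix.J (Fin 2) ℂ)
    {F : ℂ → Matrix (Fin 2 ⊕ Fin 2) (Fin 2 ⊕ Fin 2) ℂ → ℂ}
    (hP : ∀ s : ℂ, 1 / 2 < s.re → IsArchSiegelSection (fun z : ℂ => (conj z / ((‖z‖ : ℝ) : ℂ)) ^ (1 : ℤ)) s (F s))
    (hK : ∀ s : ℂ, 1 / 2 < s.re → ∀ u : Matrix (Fin 2 ⊕ Fin 2) (Fin 2 ⊕ Fin 2) ℂ, uᴴ * Matrix.J (Fin 2) ℂ * u = Matrix.J (Fin 2) ℂ →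
      moeb u (I • (1 : Matrix (Fin 2) (Fin 2) ℂ)) = I • 1 →
        F s u = archScalarSection 1 (1 / 2) u *
          conj (((denom u (I • (1 : Matrix (Fin 2) (Fin 2) ℂ)))⁻¹ * denom u (-(I • (1 : Matrix (Fin 2) (Fin 2) ℂ))) * b).trace))
    {Fn : ℂ → ℂ} (hFn : DifferentiableOn ℂ Fn {s : ℂ | 0 < s.re})
    (hagree : ∀ s : ℂ, 1 / 2 < s.re → Fn s = archIntertwiningNormalized s (F s) h) :
    Fn (1 / 2) = 0 := by
  -- the closed form `G s = ((1−2s)/(1+2s))·φ⁻_{b,−s}(h)` on `{0 < re s}`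
  set T : ℂ := conj (((denom h (I • (1 : Matrix (Fin 2) (Fin 2) ℂ)))⁻¹ * denom h (-(I • (1 : Matrix (Fin 2) (Fin 2) ℂ))) * b).trace) with hT
  have hhalf : ∀ s : ℂ, 1 / 2 < s.re → Fn s = (1 - 2 * s) / (1 + 2 * s) * (archScalarSection 1 (-s) h * T) := by
    intro s hs'
    have hF : ∀ g : Matrix (Fin 2 ⊕ Fin 2) (Fin 2 ⊕ Fin 2) ℂ, gᴴ * Matrix.J (Fin 2) ℂ * g = Matrix.J (Fin 2) ℂ →
        F s g = archScalarSection 1 s g *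
          conj (((denom g (I • (1 : Matrix (Fin 2) (Fin 2) ℂ)))⁻¹ * denom g (-(I • (1 : Matrix (Fin 2) (Fin 2) ℂ))) * b).trace) :=
      fun g hg => eq_pMinusCarrier_of_flat (l := Fin 2) 1 s (1 / 2) b (hP s hs') (hK s hs') hg
    rw [hagree s hs', archIntertwiningNormalized_apply, archIntertwining_congr_UJ hF hh, ← archIntertwiningNormalized_apply,
      archIntertwiningNormalized_pMinusCarrier_one hs' hh hb]
  have hUo : IsOpen {s : ℂ | 0 < s.re} := isOpen_lt continuous_const Complex.continuous_re
  have hUc : IsPreconnected {s : ℂ | 0 < s.re} := (convex_halfSpace_re_gt (0 : ℝ)).isPreconnected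
  have hG : DifferentiableOn ℂ (fun s : ℂ => (1 - 2 * s) / (1 + 2 * s) * (archScalarSection 1 (-s) h * T)) {s : ℂ | 0 < s.re} := by
    refine DifferentiableOn.mul ?_ (((differentiable_archScalarSection_neg_param 1 hh).mul (differentiable_const T)).differentiableOn)
    refine DifferentiableOn.div (by fun_prop) (by fun_prop) fun s hs' => one_add_two_mul_ne_zero hs'
  have h1U : (1 : ℂ) ∈ {s : ℂ | 0 < s.re} := by
    simp only [mem_setOf_eq, Complex.one_re]
    norm_num
  have hev : Fn =ᶠ[𝓝 (1 : ℂ)] fun s => (1 - 2 * s) / (1 + 2 * s) * (archScalarSection 1 (-s) h * T) := by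
    have hO : IsOpen {s : ℂ | 1 / 2 < s.re} := isOpen_lt continuous_const Complex.continuous_re
    have h1 : (1 : ℂ) ∈ {s : ℂ | 1 / 2 < s.re} := by
      simp only [mem_setOf_eq, Complex.one_re]
      norm_num
    exact Filter.eventuallyEq_of_mem (hO.mem_nhds h1) fun s hs' => hhalf s hs'
  have heq := (hFn.analyticOnNhd hUo).eqOn_of_preconnected_of_eventuallyEq (hG.analyticOnNhd hUo) hUc h1U hev one_half_re_pos
  rw [heq]
  simp only
  rw [show (1 - 2 * (1 / 2 : ℂ)) = 0 by ring, zero_div, zero_mul]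

end Summit.HodgeConjecture.HodgeConjecture.Cruxes.HLiu418.K2LiuArchPMinusIntertwiningKernel

end
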